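import Summits.QuantumFields.YangMills.Theorems.BalabanUVNodesN26SlopeOfRecord13

/-!
# DAG node N26 — THE N26 FACES RE-KEYED TO NODE 00's SEPARATED-RANGE STAGE-13 DATUM `Node00.datumOfRecord₁₃Sep θ (h : θ.Provisos₁₃Sep F N)` (node00-def-T
# `Node00/Record13.lean` v1.2, p501191 — the print-faithful proviso of route rev 18's ⁗ items): ONE universal adapter + the generic, record-level and witness faces

Cell `pub-ymgap`, YM-PLAN Track A (HUMAN RULING D-0062), seat `pub-ymgap-dag-n26-c` gen 8 (R134 acceleration seat, s2); helper for crux K2‴ `EndpointGivenBR13` (stmt-QuantumFields-19911)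
and its rev-18 successor K2⁗ `EndpointGivenBR13Sep` (plan g67 ACK-138: the item texts re-keyed by the token map `Provisos₁₃ ↦ Provisos₁₃Sep`, `datumOfRecord₁₃ ↦ datumOfRecord₁₃Sep`, nothing
else).  Trigger (t24) of this lineage's HANDOFF: director-ym №138 (gate5 refuses a same-name in-place body change ⇒ DEPRECATE-AND-ADD) and def-T's v1.2 — the Stage-13 provisos re-pointed
to the SEPARATED support guard `suppOfRecord₁₃Sep` with the partition-compatibility antecedent `PartCompat₁₃` (row `bg` print-faithful: [6] (1.3)–(1.6)), the datum `datumOfRecord₁₃Sep`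
over them, and the `rfl` bridges `βfun_datumOfRecord₁₃Sep : (datumOfRecord₁₃Sep F N θ h).βfun = betaOfRecord₁₃ F N θ`, `datumOfRecord₁₃Sep_toSep : datumOfRecord₁₃Sep F N θ h.toSep =
datumOfRecord₁₃ F N θ h`.  The β-side of N26 never read the provisos (only the datum is formed with them), so the re-key is ONE adapter:

WHAT IS HERE (0 `def`, 0 `sorry`; every proof `rfl` ∕ `Iff.rfl` ∕ one application of a landed theorem):
* §0 `betaContH_datumOfRecord₁₃Sep_iff` (B4 on a box at the separated-range datum ⟺ B4 at `betaOfRecord₁₃ F N θ`, `Iff.rfl`), ★ `n26_datumOfRecord₁₃Sep_of_betaContH` — THE UNIVERSAL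
  ADAPTER: any `BetaContH γ₀ (betaOfRecord₁₃ F N θ)` face of this lineage with `0 < γ₀` (p491248 `betaContH_betaOfRecord₁₃_of_localizedRep` ∕ `_of_family`, p492818
  `…_theta13LiveOfFamily₂_of_family`, p494179 `…_theta13LiveOfNumerics_of_family`, p497583 `…_theta13OfThm1_of_family`, p497784 `…_theta13OfThm1C_of_family`) ⟹
  `∃ γc > 0, BetaContH γc (datumOfRecord₁₃Sep F N θ hP).βfun` in ONE application — so every `n26_datumOfRecord₁₃_X (hP : θ.Provisos₁₃ F N)` face of the lineage has its
  `Provisos₁₃Sep` twin by name; `n26_datumOfRecord₁₃Sep_toSep_iff` ∕ `endpointExistence_datumOfRecord₁₃Sep_toSep_iff` (along `Provisos₁₃.toSep` N26 and N25's END at the v1.2 datum ARE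
  the v1.1 statements, `Iff.rfl`).
* §1 the generic faces at the separated-range datum: `n26_datumOfRecord₁₃Sep_of_atSlopeCont` (rows (D4) ∧ B4's residue at ANY split, any slope ⟹ N26), `endpoint_and_n26_datumOfRecord₁₃Sep_of_residue_atSlopeCont`
  (row (D1)'s residue pinned on a split + `AtSlopeCont` at its slope ⟹ N25's END ∧ N26 — `Gaps.BetaContFromD4Chain.endpointExistence_of_residue_atSlopeCont` at the datum's own `fwd`),
  `oneLoopDrift_beta0_of_pin_residue₁₃` (the registered (D1) pair ⟹ `∃ A, OneLoopDrift (stepBal Nc Lc) A β⁰_θ`: the jets-free drift of the record's one-loop numbers), ★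
  `endpoint_and_n26_datumOfRecord₁₃Sep_of_drift_atSlopeCont` (K2⁗ AT θ FROM THE JETS-FREE PAIR «drift of β⁰_θ with slope d» + «`AtSlopeCont` at d»: NO jets, NO residue, NO `(Lc, Nc)` —
  ym-nodeO-ideate P3 EVIDENCE-54 v3 (T5) `DDrift13P` in the tree; `Beta.DriftRemainder.endpointExistence_of_drift_remainderConst_cont` at the datum's `fwd`).
* §2 record level over def-T's `IsRecordOfRecord₁₃CSep`: `n26_of_isRecordOfRecord₁₃CSep_of_atSlopeCont`, `endpoint_and_n26_of_isRecordOfRecord₁₃CSep_of_residue_atSlopeCont` (twins of p491248 §2).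
* §3 AT NODE 00's K0 CANDIDATE WITNESS θ₁₅ᶜ = `theta13OfThm1C F N ε₀ ε₂₉ B₃ a₀ a₁` (node00-def-K0a FILE 11a; the `…ScaledSep`-keyed member, K0a `bgSep_theta13OfThm1C_of_thm1ScaledSep_of_monotone`):
  `n26_datumOfRecord₁₃Sep_theta13OfThm1C_of_family` — N26 at the separated-range datum of θ₁₅ᶜ from the (D4) family road + (C-pt), N1 DISCHARGED modulo `hsmall₁` ∕ `hA₂`, no κ hypothesis,
  the v1.2 provisos `hP : θ₁₅ᶜ.Provisos₁₃Sep F N` displayed (p497784 §2's face through §0's adapter).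
* §4 `d4AtSlopeOfD1Record13Sep_iff_atDrift`: crux K2⁗'s stub 2 text — plan g66's `K2Skeleton13.D4AtSlopeOfD1Record13` under plan g67's rev-18 token map (`Provisos₁₃ ↦ Provisos₁₃Sep`,
  nothing else on the β-side; ACK-138 (C)) — ⟺ ITS ONE-SLOPE-PER-θ FORM (p502604 §3 re-keyed: the seam slope is the record's one-loop Cesàro drift, `tendsto_div_beta0_of_pin_residue₁₃`).

HONEST FRAMING.  Re-keying bookkeeping (`rfl`-level); the displayed inputs of §3 are NODE O ∕ def-T ∕ NODE B ∕ NODE E objects exactly as in p497784; nothing of Bałaban's analysis is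
asserted; (D4) INSTANCE 0∕1; `stub_d4AtSlopeCont13` ∕ K2‴ ∕ K2⁗ NOT proved; N25 ∕ N26 NOT discharged (N26 VACATED ∕ (D4)-dependent; counts unmoved 5∕27 · A 5∕28); general `N`; one finite
four-torus programme at fixed ε per run — NOT the continuum limit, NOT ℝ⁴, NOT OS, NOT a mass gap, NOT Clay.  No `instance`, no `notation`, no `axiom`.
Sources (context): [I] = [Balaban1987RG1] CMP **109** (1987): Thm 2 p. 259 (first sentence), (1.7) p. 261, (1.20)–(1.22) p. 264, (2.9) p. 266, (2.12)–(2.14) p. 268, (5.10) p. 293;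
[II] = [Balaban1988RG2Cluster] CMP **116** (1988): Lemma 3 (2.38) p. 20, p. 21; [III] = [Balaban1988Convergent] CMP **119** (1988): (0.2) p. 244, (2.10) p. 256;
[6] = [Balaban1989LargeFieldII] CMP **122** (1989): Thm 1 + (0.1) pp. 355–356, (1.3)–(1.6); [15] = [Balaban1985Variational] CMP **102** (1985): Thm 1 p. 279, (190) p. 308.
-/

noncomputable section

open scoped Matrix.Norms.L2Operator

namespace Summit.QuantumFields.YangMills.Theorems.BalabanUVNodesN26AtRecord13Sep

open Literature.MathematicalPhysics.QuantumFieldTheory.Balaban1983to89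
open Literature.MathematicalPhysics.QuantumFieldTheory.Balaban1983to89.FlowStep
open Literature.MathematicalPhysics.QuantumFieldTheory.Balaban1983to89.DagBinding (EndpointExistence WorldP)
open Literature.MathematicalPhysics.QuantumFieldTheory.Balaban1983to89.T4Continuum (T4Family FiniteEpsData)
open Literature.MathematicalPhysics.QuantumFieldTheory.Balaban1983to89.Node00
open Literature.MathematicalPhysics.QuantumFieldTheory.Balaban1983to89.B13ScaleTransfer (Pt)
open Literature.MathematicalPhysics.QuantumFieldTheory.Balaban1983to89.B12TreeDecay (K₀)
open Literature.MathematicalPhysics.QuantumFieldTheory.Balaban1983to89.Beta.RemainderChainLattice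
open Literature.MathematicalPhysics.QuantumFieldTheory.Balaban1983to89.TreeLengthTorus (TDom proj)
open Literature.MathematicalPhysics.QuantumFieldTheory.Balaban1983to89.B12Decay510 (mixedDeriv)
open Literature.MathematicalPhysics.QuantumFieldTheory.Balaban1983to89.Beta.RemainderLimitTorus (LDom limKernel tproj)
open Literature.MathematicalPhysics.QuantumFieldTheory.Balaban1983to89.Beta.RemainderWOfRecordB13
open Literature.MathematicalPhysics.QuantumFieldTheory.Balaban1983to89.Beta.RemainderDecay190
open Literature.MathematicalPhysics.QuantumFieldTheory.Balaban1983to89.Beta.OneStepKernelFamily (TbalOf)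
open Literature.MathematicalPhysics.QuantumFieldTheory.Balaban1983to89.Beta.OneStepResolventKernel (JetData)
open Literature.MathematicalPhysics.QuantumFieldTheory.Balaban1983to89.Beta.Drift (OneLoopDrift)
open Literature.MathematicalPhysics.QuantumFieldTheory.Balaban1983to89.Beta.DriftRemainder (endpointExistence_of_drift_remainderConst_cont)
open Summit.QuantumFields.BalabanUV.Gaps
open Summit.QuantumFields.BalabanUV.Gaps.BetaContFromD4Chain
open Summit.QuantumFields.YangMills.Theorems.BalabanUVNodesN26AtTheta13OfThm1C (betaContH_betaOfRecord₁₃_theta13OfThm1C_of_family)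
open Summit.QuantumFields.YangMills.Theorems.BalabanUVNodesN26SlopeOfRecord13 (tendsto_div_beta0_of_pin_residue₁₃)
open Metric
open Filter Topology

variable (F : T4Family) (N : ℕ) [NeZero N]

/-! ## §0 The universal adapter: N26 at the separated-range datum reads `betaOfRecord₁₃ F N θ` and nothing of the provisos -/

section Adapter

variable (θ : Stage13Params F N)

/-- **B4 on a box at the separated-range Stage-13 datum ⟺ B4 at `betaOfRecord₁₃ F N θ`** (def-T `βfun_datumOfRecord₁₃Sep`, `rfl`). [cite: Balaban1987RG1, (1.20)–(1.22) p.264 (bookkeeping)] -/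
theorem betaContH_datumOfRecord₁₃Sep_iff (hP : θ.Provisos₁₃Sep F N) (γ : ℝ) :
    BetaContH γ (datumOfRecord₁₃Sep F N θ hP).βfun ↔ BetaContH γ (betaOfRecord₁₃ F N θ) := Iff.rfl

/-- **★ THE UNIVERSAL ADAPTER — N26 AT THE SEPARATED-RANGE DATUM FROM ANY B4 FACE AT `betaOfRecord₁₃ F N θ` ON A BOX `0 < γ₀`**: every `betaContH_betaOfRecord₁₃_X` theorem of this lineage
(socket inputs p491248 §1, family road p491248 §1b, the witness families p492818 §3 ∕ p494179 §3 ∕ p497583 §2 ∕ p497784 §2) gives the `Provisos₁₃Sep`-keyed N26 face in ONE application.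
Instance 0∕1; N26 NOT discharged. [cite: Balaban1987RG1, (1.20)–(1.22) p.264; Balaban1989LargeFieldII, Thm 1 + (0.1) pp.355–356 (the record)] -/
theorem n26_datumOfRecord₁₃Sep_of_betaContH (hP : θ.Provisos₁₃Sep F N) {γ₀ : ℝ} (hγ₀ : 0 < γ₀) (h : BetaContH γ₀ (betaOfRecord₁₃ F N θ)) :
    ∃ γc : ℝ, 0 < γc ∧ BetaContH γc (datumOfRecord₁₃Sep F N θ hP).βfun :=
  ⟨γ₀, hγ₀, h⟩

/-- **Along `Provisos₁₃.toSep`, N26 at the v1.2 datum IS N26 at the v1.1 datum** (def-T `datumOfRecord₁₃Sep_toSep`, `rfl`): every `n26_datumOfRecord₁₃_X (hP : θ.Provisos₁₃ F N)` face of the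
lineage is, verbatim, the v1.2 face at `hP.toSep`. [cite: Balaban1989LargeFieldII, Thm 1 + (0.1) pp.355–356 (bookkeeping)] -/
theorem n26_datumOfRecord₁₃Sep_toSep_iff (h : θ.Provisos₁₃ F N) :
    (∃ γc : ℝ, 0 < γc ∧ BetaContH γc (datumOfRecord₁₃Sep F N θ h.toSep).βfun) ↔
      ∃ γc : ℝ, 0 < γc ∧ BetaContH γc (datumOfRecord₁₃ F N θ h).βfun := Iff.rfl

/-- **Along `Provisos₁₃.toSep`, N25's END at the v1.2 datum IS the END at the v1.1 datum** (`rfl`). [cite: Balaban1987RG1, Thm 2 p.259 (first sentence; bookkeeping)] -/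
theorem endpointExistence_datumOfRecord₁₃Sep_toSep_iff (h : θ.Provisos₁₃ F N) :
    EndpointExistence (datumOfRecord₁₃Sep F N θ h.toSep).C.toB12 ↔ EndpointExistence (datumOfRecord₁₃ F N θ h).C.toB12 := Iff.rfl

end Adapter

/-! ## §1 The generic faces at the separated-range datum: residue ∕ (D1) + (D4) currencies -/

section AtDatum

variable (θ : Stage13Params F N)

/-- **N26 AT THE SEPARATED-RANGE STAGE-13 DATUM FROM THE ROWS-(D4) ∧ B4 RESIDUE** at ANY split of the datum's β on a box `0 < γ₀`, any slope
(`Gaps.BetaContFromD4Chain.betaContH_of_atSlopeCont`).  A located hypothesis of NODE O; instance 0∕1. [cite: Balaban1988RG2Cluster, Lemma 3 (2.38) p.20; Balaban1987RG1, (1.20)–(1.22) p.264 and (5.10) p.293] -/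
theorem n26_datumOfRecord₁₃Sep_of_atSlopeCont (hP : θ.Provisos₁₃Sep F N) {γ₀ : ℝ} (hγ₀ : 0 < γ₀)
    {Sβ : B12Beta.OneLoopSplit (datumOfRecord₁₃Sep F N θ hP).βfun} {s : ℝ} (h : AtSlopeCont Sβ γ₀ s) :
    ∃ γc : ℝ, 0 < γc ∧ BetaContH γc (datumOfRecord₁₃Sep F N θ hP).βfun :=
  ⟨γ₀, hγ₀, betaContH_of_atSlopeCont h⟩

/-- **N25's END ∧ N26 AT THE SEPARATED-RANGE STAGE-13 DATUM**: row (D1)'s residue `Gaps.D1Residue.Residue Lc Js Nc μ ν` pinned on the one-loop field of a split `Sβ` of the datum's β and the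
rows-(D4) ∧ B4 residue `AtSlopeCont Sβ γ₀ (stepBal Nc Lc)` on a box `0 < γ₀` ⟹ `EndpointExistence D.C.toB12 ∧ ∃ γc > 0, BetaContH γc D.βfun` at `D := datumOfRecord₁₃Sep θ hP`
(`Gaps.BetaContFromD4Chain.endpointExistence_of_residue_atSlopeCont` at the datum's own `fwd`) — crux K2⁗'s two stubs composed at the v1.2 datum.  Instance 0∕1 on both predicates.
[cite: Balaban1987RG1, Thm 2 p.259 (first sentence), (1.20)–(1.22) p.264 and (2.12)–(2.14) p.268; Balaban1988RG2Cluster, Lemma 3 (2.38) p.20] -/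
theorem endpoint_and_n26_datumOfRecord₁₃Sep_of_residue_atSlopeCont (hP : θ.Provisos₁₃Sep F N)
    (Sβ : B12Beta.OneLoopSplit (datumOfRecord₁₃Sep F N θ hP).βfun) {Lc : ℕ} [NeZero Lc] (Js : ℕ → JetData 3 Lc) {Nc : ℝ} {μ ν : Fin 4}
    (hβ : ∀ j, Sβ.β0 j = B12Beta.secondMoment (TbalOf Lc Js j) μ ν) (h1 : D1Residue.Residue Lc Js Nc μ ν) {γ₀ : ℝ} (hγ₀ : 0 < γ₀)
    (hres : AtSlopeCont Sβ γ₀ (B12Normalization.stepBal Nc Lc)) :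
    EndpointExistence (datumOfRecord₁₃Sep F N θ hP).C.toB12 ∧ ∃ γc : ℝ, 0 < γc ∧ BetaContH γc (datumOfRecord₁₃Sep F N θ hP).βfun :=
  ⟨endpointExistence_of_residue_atSlopeCont (datumOfRecord₁₃Sep F N θ hP).fwd Sβ Js hβ h1 hγ₀ hres, γ₀, hγ₀, betaContH_of_atSlopeCont hres⟩

/-- **THE REGISTERED (D1) PAIR GIVES THE JETS-FREE DRIFT OF THE RECORD's ONE-LOOP NUMBERS** (any θ, no proviso): the pin `hβ` + `Residue Lc Js Nc 0 1` ⟹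
`∃ A, OneLoopDrift (stepBal Nc Lc) A β⁰_θ` with `β⁰_θ = beta0OfMerged β_m θ.v₀` (`Gaps.D1Residue.d1Drift_of_residue` rewritten along the pin; ym-nodeO-ideate P3 EVIDENCE-54 v3's
memo shape `oneLoopDrift_of_pinned_residue`, here in the tree). [cite: Balaban1987RG1, (2.12)–(2.13) p.268 and (1.22) p.264] -/
theorem oneLoopDrift_beta0_of_pin_residue₁₃ {Lc : ℕ} [NeZero Lc] {Js : ℕ → JetData 3 Lc} {Nc : ℝ}
    (hβ : letI := θ.instVβ₁; letI := θ.instVβ₂; letI := θ.instιβ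
      ∀ j, beta0OfMerged (betaMerged F (mergedTermFamilyMatT F N (TcanOfRecord F N) (chiFixed29 F N θ.ν θ.ε₂₉) θ.εbg) θ.ρ8 θ.bV) θ.v₀ j =
        B12Beta.secondMoment (TbalOf Lc Js j) 0 1)
    (h : D1Residue.Residue Lc Js Nc 0 1) :
    letI := θ.instVβ₁; letI := θ.instVβ₂; letI := θ.instιβ
    ∃ A : ℝ, OneLoopDrift (B12Normalization.stepBal Nc Lc) A
      (beta0OfMerged (betaMerged F (mergedTermFamilyMatT F N (TcanOfRecord F N) (chiFixed29 F N θ.ν θ.ε₂₉) θ.εbg) θ.ρ8 θ.bV) θ.v₀) := by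
  obtain ⟨A, hA⟩ := D1Residue.d1Drift_of_residue Js h
  have e : (fun j => B12Beta.secondMoment (TbalOf Lc Js j) 0 1) =
      (letI := θ.instVβ₁; letI := θ.instVβ₂; letI := θ.instιβ
       beta0OfMerged (betaMerged F (mergedTermFamilyMatT F N (TcanOfRecord F N) (chiFixed29 F N θ.ν θ.ε₂₉) θ.εbg) θ.ρ8 θ.bV) θ.v₀) :=
    funext fun j => (hβ j).symm
  rw [e] at hA
  exact ⟨A, hA⟩

/-- **★ CRUX K2⁗ AT θ FROM THE JETS-FREE PAIR** (ym-nodeO-ideate P3 EVIDENCE-54 v3 (T5) `DDrift13P`, here in the tree at the separated-range datum): a drift of the record's one-loop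
numbers `OneLoopDrift d A β⁰_θ` + the rows-(D4) ∧ B4 residue `AtSlopeCont (split₁₃ θ) γ₀ d` AT THAT SLOPE on a box `0 < γ₀` ⟹ N25's END ∧ N26 at `datumOfRecord₁₃Sep θ hP` — NO jets,
NO `Residue`, NO `(Lc, Nc)` (`Beta.DriftRemainder.endpointExistence_of_drift_remainderConst_cont` at the datum's own `fwd`, `r := b := d`, with `remainderConst_of_atSlopeCont` ∕
`betaContH_of_atSlopeCont`).  By `oneLoopDrift_beta0_of_pin_residue₁₃` the REGISTERED pair (pin + residue, `AtSlopeCont` at `stepBal Nc Lc`) is an instance.  Instance 0∕1; N25 ∕ N26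
NOT discharged. [cite: Balaban1987RG1, Thm 2 p.259 (first sentence), (1.20)–(1.22) p.264 and (2.12)–(2.14) p.268; Balaban1988RG2Cluster, Lemma 3 (2.38) p.20 and (2.41) p.21] -/
theorem endpoint_and_n26_datumOfRecord₁₃Sep_of_drift_atSlopeCont (hP : θ.Provisos₁₃Sep F N) {d A γ₀ : ℝ}
    (hdrift : letI := θ.instVβ₁; letI := θ.instVβ₂; letI := θ.instιβ
      OneLoopDrift d A
        (beta0OfMerged (betaMerged F (mergedTermFamilyMatT F N (TcanOfRecord F N) (chiFixed29 F N θ.ν θ.ε₂₉) θ.εbg) θ.ρ8 θ.bV) θ.v₀))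
    (hγ₀ : 0 < γ₀)
    (hres : letI := θ.instVβ₁; letI := θ.instVβ₂; letI := θ.instιβ
      AtSlopeCont
        (oneLoopSplit_betaOfMerged (betaMerged F (mergedTermFamilyMatT F N (TcanOfRecord F N) (chiFixed29 F N θ.ν θ.ε₂₉) θ.εbg) θ.ρ8 θ.bV)
          (beta0OfMerged (betaMerged F (mergedTermFamilyMatT F N (TcanOfRecord F N) (chiFixed29 F N θ.ν θ.ε₂₉) θ.εbg) θ.ρ8 θ.bV) θ.v₀) θ.γ)
        γ₀ d) :
    EndpointExistence (datumOfRecord₁₃Sep F N θ hP).C.toB12 ∧ ∃ γc : ℝ, 0 < γc ∧ BetaContH γc (datumOfRecord₁₃Sep F N θ hP).βfun :=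
  ⟨endpointExistence_of_drift_remainderConst_cont (datumOfRecord₁₃Sep F N θ hP).fwd (oneLoopSplit_betaOfMerged _ _ _) hγ₀ hdrift
      (remainderConst_of_atSlopeCont hres) le_rfl (betaContH_of_atSlopeCont hres),
    γ₀, hγ₀, betaContH_of_atSlopeCont hres⟩

end AtDatum

/-! ## §2 Record level over def-T's `IsRecordOfRecord₁₃CSep`: N26, and N25's END ∧ N26, per admissible separated-range presentation on the world's window -/

section Route

/-- **N26 AT A SEPARATED-RANGE STAGE-13 RECORD `(D, w)` FROM THE RESIDUE ON THE WORLD's OWN WINDOW**: if every admissible presentation `θ` (with `Provisos₁₃Sep`) of `D` with `w.γ ≤ θ.γ`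
carries, at SOME split of `D`'s β and SOME slope, `AtSlopeCont Sβ w.γ s`, then `∃ γc > 0, BetaContH γc D.βfun` (`γc := w.γ`).  Instance 0∕1; N26 NOT discharged.
[cite: Balaban1987RG1, (1.20)–(1.22) p.264; Balaban1988RG2Cluster, Lemma 3 (2.38) p.20; Balaban1989LargeFieldII, Thm 1 p.355 (the record)] -/
theorem n26_of_isRecordOfRecord₁₃CSep_of_atSlopeCont {D : FiniteEpsData F (Matrix.specialUnitaryGroup (Fin N) ℂ)} {w : WorldP}
    (h : IsRecordOfRecord₁₃CSep F N D w)
    (hin : ∀ (θ : Stage13Params F N) (hP : θ.Provisos₁₃Sep F N), θ.Admissible F N → D = datumOfRecord₁₃Sep F N θ hP → w.γ ≤ θ.γ →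
      ∃ (Sβ : B12Beta.OneLoopSplit D.βfun) (s : ℝ), AtSlopeCont Sβ w.γ s) :
    ∃ γc : ℝ, 0 < γc ∧ BetaContH γc D.βfun := by
  obtain ⟨θ, hP, hθ, hD, -, ⟨hγ0, hγle⟩, -, -⟩ := h
  obtain ⟨Sβ, s, hs⟩ := hin θ hP hθ hD hγle
  exact ⟨w.γ, hγ0, betaContH_of_atSlopeCont hs⟩

/-- **N25's END ∧ N26 AT A SEPARATED-RANGE STAGE-13 RECORD `(D, w)`, predicate form, residue currency** (the (D1) + rows-(D4) ∧ B4 package per admissible presentation, on the world's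
window, at the one-loop slope).  Instance 0∕1; N25 ∕ N26 NOT discharged. [cite: Balaban1987RG1, Thm 2 p.259 (first sentence) and (1.20)–(1.22) p.264; Balaban1988RG2Cluster, Lemma 3 (2.38) p.20; Balaban1989LargeFieldII, Thm 1 p.355] -/
theorem endpoint_and_n26_of_isRecordOfRecord₁₃CSep_of_residue_atSlopeCont {D : FiniteEpsData F (Matrix.specialUnitaryGroup (Fin N) ℂ)} {w : WorldP}
    (h : IsRecordOfRecord₁₃CSep F N D w)
    (hin : ∀ (θ : Stage13Params F N) (hP : θ.Provisos₁₃Sep F N), θ.Admissible F N → D = datumOfRecord₁₃Sep F N θ hP → w.γ ≤ θ.γ →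
      ∃ (Sβ : B12Beta.OneLoopSplit D.βfun) (Lc : ℕ) (_ : NeZero Lc) (Js : ℕ → JetData 3 Lc) (Nc : ℝ) (μ ν : Fin 4),
        (∀ j, Sβ.β0 j = B12Beta.secondMoment (TbalOf Lc Js j) μ ν) ∧ D1Residue.Residue Lc Js Nc μ ν ∧
        AtSlopeCont Sβ w.γ (B12Normalization.stepBal Nc Lc)) :
    EndpointExistence D.C.toB12 ∧ ∃ γc : ℝ, 0 < γc ∧ BetaContH γc D.βfun := by
  obtain ⟨θ, hP, hθ, hD, -, ⟨hγ0, hγle⟩, -, -⟩ := h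
  obtain ⟨Sβ, Lc, _, Js, Nc, μ, ν, hβ, h1, hres⟩ := hin θ hP hθ hD hγle
  subst hD
  exact endpoint_and_n26_datumOfRecord₁₃Sep_of_residue_atSlopeCont F N θ hP Sβ Js hβ h1 hγ0 hres

end Route

/-! ## §3 At NODE 00's K0 candidate witness θ₁₅ᶜ: N26 at the separated-range datum from the (D4) family road + (C-pt), N1 discharged modulo `hsmall₁` ∕ `hA₂` -/

section RoadAtTheta15

variable {γ₀ : ℝ} {M : ℕ} [NeZero M] {μ ν : Fin 4} {α₂ : ℝ} {q : Consts190}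
variable (ε₀ ε₂₉ B₃ a₀ a₁ : ℝ) (c₀ : B13.Consts)
  (lamF : ResidB13Fam₁₂ F N (theta13OfThm1C F N ε₀ ε₂₉ B₃ a₀ a₁).toStage12Params) (hγ₀ : 0 < γ₀) (hle : γ₀ ≤ (theta13OfThm1C F N ε₀ ε₂₉ B₃ a₀ a₁).γ)
  (A1 : (k : ℕ) → (Fin (k + 1) → ℝ) → LDom 4 → Pt 4 → ℝ)
  (hm : letI := (theta13OfThm1C F N ε₀ ε₂₉ B₃ a₀ a₁).instVβ₁; letI := (theta13OfThm1C F N ε₀ ε₂₉ B₃ a₀ a₁).instVβ₂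
    letI := (theta13OfThm1C F N ε₀ ε₂₉ B₃ a₀ a₁).instιβ
    ∀ k (v : Fin (k + 1) → ℝ), v ∈ Box γ₀ k →
      betaMerged F (mergedTermFamilyMatT F N (TcanOfRecord F N)
          (chiFixed29 F N (theta13OfThm1C F N ε₀ ε₂₉ B₃ a₀ a₁).ν (theta13OfThm1C F N ε₀ ε₂₉ B₃ a₀ a₁).ε₂₉)
          (theta13OfThm1C F N ε₀ ε₂₉ B₃ a₀ a₁).εbg) (theta13OfThm1C F N ε₀ ε₂₉ B₃ a₀ a₁).ρ8
          (theta13OfThm1C F N ε₀ ε₂₉ B₃ a₀ a₁).bV k v =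
        beta0OfMerged (betaMerged F (mergedTermFamilyMatT F N (TcanOfRecord F N)
            (chiFixed29 F N (theta13OfThm1C F N ε₀ ε₂₉ B₃ a₀ a₁).ν (theta13OfThm1C F N ε₀ ε₂₉ B₃ a₀ a₁).ε₂₉)
            (theta13OfThm1C F N ε₀ ε₂₉ B₃ a₀ a₁).εbg) (theta13OfThm1C F N ε₀ ε₂₉ B₃ a₀ a₁).ρ8
            (theta13OfThm1C F N ε₀ ε₂₉ B₃ a₀ a₁).bV) (theta13OfThm1C F N ε₀ ε₂₉ B₃ a₀ a₁).v₀ k +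
          B12Beta.secondMoment (fun _ _ => limKernel (A1 k v)) μ ν)
  (hcF : ∀ P k v, v ∈ Box γ₀ k →
    (lamF P k v).c = c13OfRecord₁₂ F N (theta13OfThm1C F N ε₀ ε₂₉ B₃ a₀ a₁).toStage12Params { c₀ with ε₁ := ε₂₉ })
  (hleafF : ∀ P, B13FamLeafOfRecord₁₂ F N (theta13OfThm1C F N ε₀ ε₂₉ B₃ a₀ a₁).toStage12Params { c₀ with ε₁ := ε₂₉ } lamF P)
  (Ps : (k : ℕ) → (Fin (k + 1) → ℝ) → ℕ → B12.RunParams)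
  (hn : ∀ k v, v ∈ Box γ₀ k → Tendsto (fun m => (lamF (Ps k v m) k v).n) atTop atTop)
  (hsp : ∀ k v, v ∈ Box γ₀ k → ∀ m, SpLaw (lamF (Ps k v m) k v)) (h213 : ∀ k v, v ∈ Box γ₀ k → ∀ m, Law213 (lamF (Ps k v m) k v))
  (hR : ∀ k v, v ∈ Box γ₀ k → ∀ m, (lamF (Ps k v m) k v).Restr)
  (hsmall₁ : 2 * ((F.L : ℝ) + 2) ^ 4 * c₀.A₁ * c₀.K₀ * ε₂₉ * Real.exp (5 * 20000 + 1) * K₀ 64 8 * 9 * 64 ≤ 1)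
  (hA₂ : Real.exp 1 * 9 * 64 * K₀ 64 8 ^ 2 ≤ c₀.A₂)
  (hs : SignsL (c13OfRecord₁₂ F N (theta13OfThm1C F N ε₀ ε₂₉ B₃ a₀ a₁).toStage12Params { c₀ with ε₁ := ε₂₉ }) α₂ q.B₃)
  (Wn : (k : ℕ) → (Fin (k + 1) → ℝ) → ℕ → Type) (instW : ∀ k v m, NormedAddCommGroup (Wn k v m))
  (instWs : ∀ k v m, NormedSpace ℂ (Wn k v m))
  (emb : (k : ℕ) → (v : Fin (k + 1) → ℝ) → (m : ℕ) → TDom 4 ((lamF (Ps k v m) k v).n + 1) → Wn k v m → (lamF (Ps k v m) k v).Φ)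
  (hemb : ∀ k v, v ∈ Box γ₀ k → ∀ m X, ∀ u ∈ ball (0 : Wn k v m) α₂, emb k v m X u ∈ (lamF (Ps k v m) k v).sp2 X)
  (hH : ∀ k v, v ∈ Box γ₀ k → ∀ m (X Z : TDom 4 ((lamF (Ps k v m) k v).n + 1)), Z.1 ⊆ X.1 →
    DifferentiableOn ℂ (fun u => (lamF (Ps k v m) k v).H Z (emb k v m X u)) (ball 0 α₂))
  (D : (k : ℕ) → (v : Fin (k + 1) → ℝ) → Data190 4 M (NOfLayers fun m => lamF (Ps k v m) k v) (Wn k v) q)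
  (V : (k : ℕ) → (Fin (k + 1) → ℝ) → LDom 4 → Type) (instV : ∀ k v Y, NormedAddCommGroup (V k v Y))
  (instVs : ∀ k v Y, NormedSpace ℂ (V k v Y))
  (Fw : (k : ℕ) → (v : Fin (k + 1) → ℝ) → (Y : LDom 4) → V k v Y → ℂ)
  (hFd : ∀ k v, v ∈ Box γ₀ k → ∀ Y, ∃ ρ > 0, DifferentiableOn ℂ (Fw k v Y) (ball 0 ρ))
  (r : (k : ℕ) → (v : Fin (k + 1) → ℝ) → (m : ℕ) → (Y : LDom 4) → Wn k v m →L[ℂ] V k v Y)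
  (hfac : ∀ k v, v ∈ Box γ₀ k → ∀ Y : LDom 4, ∀ᶠ m in atTop, ∀ u ∈ ball (0 : Wn k v m) α₂,
    (lamF (Ps k v m) k v).Ek1 (tproj ((lamF (Ps k v m) k v).n + 1) Y) (emb k v m (tproj ((lamF (Ps k v m) k v).n + 1) Y) u) =
      Fw k v Y (r k v m Y u))
  (t : (k : ℕ) → (v : Fin (k + 1) → ℝ) → (Y : LDom 4) → Pt 4 → V k v Y)
  (hconv : ∀ k v, v ∈ Box γ₀ k → ∀ (Y : LDom 4) (x : Pt 4),
    Tendsto (fun m => r k v m Y ((D k v).hn m (tproj ((lamF (Ps k v m) k v).n + 1) Y) (proj (((lamF (Ps k v m) k v).n + 1) * M) x)))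
      atTop (𝓝 (t k v Y x)))
  (ha : ∀ k v, v ∈ Box γ₀ k → ∀ (Y : LDom 4) (z : Pt 4), A1 k v Y z = (mixedDeriv (Fw k v Y) (t k v Y 0) (t k v Y z)).re)

include hγ₀ hle hm hcF hleafF hn hsp h213 hR hsmall₁ hA₂ hs instW instWs hemb hH hFd hfac hconv ha

/-- **N26 AT THE SEPARATED-RANGE DATUM OF RECORD OF θ₁₅ᶜ FROM THE FAMILY ROAD + (C-pt)** on a box `0 < γ₀ ≤ θ₁₅ᶜ.γ = ½` (`βfun_datumOfRecord₁₃Sep`, `rfl`):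
`∃ γc > 0, BetaContH γc (datumOfRecord₁₃Sep F N θ₁₅ᶜ hP).βfun` with the v1.2 Stage-13 provisos `hP : θ₁₅ᶜ.Provisos₁₃Sep F N` displayed (node00-def-K0a: at the `…ScaledSep`-keyed
member they cost row P11 in its SEPARATION-GUARDED form, `bgSep_theta13OfThm1C_of_thm1ScaledSep_of_monotone`), N1 DISCHARGED modulo `hsmall₁` ∕ `hA₂`, no κ hypothesis — p497784
`betaContH_betaOfRecord₁₃_theta13OfThm1C_of_family` through §0's adapter.  Instance 0∕1; N26 NOT discharged. [cite: Balaban1987RG1, (1.7) p.261, (1.18) p.263, (1.20)–(1.22) p.264, (2.9) p.266 and (5.10) p.293; Balaban1988RG2Cluster, Lemma 3 (2.38) p.20 and p.21; Balaban1985Variational, Thm 1 p.279, (190) p.308; Balaban1989LargeFieldII, Thm 1 + (0.1) pp.355–356] -/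
theorem n26_datumOfRecord₁₃Sep_theta13OfThm1C_of_family (hP : (theta13OfThm1C F N ε₀ ε₂₉ B₃ a₀ a₁).Provisos₁₃Sep F N)
    (hq : q.Valid (c13OfRecord₁₂ F N (theta13OfThm1C F N ε₀ ε₂₉ B₃ a₀ a₁).toStage12Params { c₀ with ε₁ := ε₂₉ }).δ₀)
    (hcpt : ∀ k (x : Pt 4), ContinuousOn (fun v : Fin (k + 1) → ℝ => limKernel (A1 k v) x) (Box γ₀ k)) :
    ∃ γc : ℝ, 0 < γc ∧ BetaContH γc (datumOfRecord₁₃Sep F N (theta13OfThm1C F N ε₀ ε₂₉ B₃ a₀ a₁) hP).βfun :=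
  n26_datumOfRecord₁₃Sep_of_betaContH F N (theta13OfThm1C F N ε₀ ε₂₉ B₃ a₀ a₁) hP hγ₀
    (betaContH_betaOfRecord₁₃_theta13OfThm1C_of_family F N ε₀ ε₂₉ B₃ a₀ a₁ c₀ lamF hle A1 hm hcF hleafF Ps hn hsp h213 hR hsmall₁ hA₂
      hs Wn instW instWs emb hemb hH D V instV instVs Fw hFd r hfac t hconv ha hq hcpt)

end RoadAtTheta15

/-! ## §4 Crux K2⁗'s stub 2 text (the rev-18 token map applied to `K2Skeleton13.D4AtSlopeOfD1Record13`) ⟺ its ONE-SLOPE-PER-θ form -/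

section StubSep

/-- **K2⁗'s stub 2 — `D4AtSlopeOfD1Record13` with `Provisos₁₃ ↦ Provisos₁₃Sep` (plan g67's rev-18 token map; the β-tokens are untouched) — ⟺ «AT EVERY ADMISSIBLE θ WITH SEPARATED-RANGE
PROVISOS AND A (D1) DATUM, `AtSlopeCont` OF THE RECORD's SPLIT AT THE RECORD's ONE-LOOP CESÀRO DRIFT»** (p502604 `d4AtSlopeOfD1Record13_iff_atDrift` re-keyed; (⇒) a datum's slope is the
Cesàro limit of the record's one-loop numbers, `tendsto_div_beta0_of_pin_residue₁₃`, and limits are unique; (⇐) `d := stepBal Nc Lc`).  If plan's registered ⁗ text differs from the token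
map, a successor restates against it by name. [cite: Balaban1987RG1, Thm 2 p.259 (first sentence), (1.20)–(1.22) p.264 and (2.12)–(2.13) p.268; Balaban1988RG2Cluster, Lemma 3 (2.38) p.20] -/
theorem d4AtSlopeOfD1Record13Sep_iff_atDrift :
    (∀ (F : T4Family) (θ : Stage13Params F 2) (hP : θ.Provisos₁₃Sep F 2), θ.Admissible F 2 →
      letI := θ.instVβ₁; letI := θ.instVβ₂; letI := θ.instιβ
      ∀ (Lc : ℕ) (_ : NeZero Lc) (Js : ℕ → JetData 3 Lc) (Nc : ℝ),
        (∀ j, beta0OfMerged (betaMerged F (mergedTermFamilyMatT F 2 (TcanOfRecord F 2) (chiFixed29 F 2 θ.ν θ.ε₂₉) θ.εbg) θ.ρ8 θ.bV) θ.v₀ j =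
            B12Beta.secondMoment (TbalOf Lc Js j) 0 1) →
        D1Residue.Residue Lc Js Nc 0 1 →
        ∃ γ₀ : ℝ, 0 < γ₀ ∧ γ₀ ≤ θ.γ ∧
          AtSlopeCont
            (oneLoopSplit_betaOfMerged (betaMerged F (mergedTermFamilyMatT F 2 (TcanOfRecord F 2) (chiFixed29 F 2 θ.ν θ.ε₂₉) θ.εbg) θ.ρ8 θ.bV)
              (beta0OfMerged (betaMerged F (mergedTermFamilyMatT F 2 (TcanOfRecord F 2) (chiFixed29 F 2 θ.ν θ.ε₂₉) θ.εbg) θ.ρ8 θ.bV) θ.v₀) θ.γ)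
            γ₀ (B12Normalization.stepBal Nc Lc)) ↔
    (∀ (F : T4Family) (θ : Stage13Params F 2) (hP : θ.Provisos₁₃Sep F 2), θ.Admissible F 2 →
      letI := θ.instVβ₁; letI := θ.instVβ₂; letI := θ.instιβ
      ∀ d : ℝ,
        Tendsto (fun k : ℕ => (∑ j ∈ Finset.range k,
          beta0OfMerged (betaMerged F (mergedTermFamilyMatT F 2 (TcanOfRecord F 2) (chiFixed29 F 2 θ.ν θ.ε₂₉) θ.εbg) θ.ρ8 θ.bV) θ.v₀ j) / k) atTop (𝓝 d) →
        (∃ (Lc : ℕ) (_ : NeZero Lc) (Js : ℕ → JetData 3 Lc) (Nc : ℝ),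
          (∀ j, beta0OfMerged (betaMerged F (mergedTermFamilyMatT F 2 (TcanOfRecord F 2) (chiFixed29 F 2 θ.ν θ.ε₂₉) θ.εbg) θ.ρ8 θ.bV) θ.v₀ j =
              B12Beta.secondMoment (TbalOf Lc Js j) 0 1) ∧
          D1Residue.Residue Lc Js Nc 0 1) →
        ∃ γ₀ : ℝ, 0 < γ₀ ∧ γ₀ ≤ θ.γ ∧
          AtSlopeCont
            (oneLoopSplit_betaOfMerged (betaMerged F (mergedTermFamilyMatT F 2 (TcanOfRecord F 2) (chiFixed29 F 2 θ.ν θ.ε₂₉) θ.εbg) θ.ρ8 θ.bV)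
              (beta0OfMerged (betaMerged F (mergedTermFamilyMatT F 2 (TcanOfRecord F 2) (chiFixed29 F 2 θ.ν θ.ε₂₉) θ.εbg) θ.ρ8 θ.bV) θ.v₀) θ.γ)
            γ₀ d) := by
  constructor
  · intro h F θ hP hθ d hd hex
    obtain ⟨Lc, inst, Js, Nc, hβ, hres⟩ := hex
    have hlim := tendsto_div_beta0_of_pin_residue₁₃ F 2 θ hβ hres
    have hd' : d = B12Normalization.stepBal Nc Lc := tendsto_nhds_unique hd hlim
    rw [hd']
    exact h F θ hP hθ Lc inst Js Nc hβ hres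
  · intro h F θ hP hθ Lc inst Js Nc hβ hres
    exact h F θ hP hθ (B12Normalization.stepBal Nc Lc) (tendsto_div_beta0_of_pin_residue₁₃ F 2 θ hβ hres) ⟨Lc, inst, Js, Nc, hβ, hres⟩

end StubSep

end Summit.QuantumFields.YangMills.Theorems.BalabanUVNodesN26AtRecord13Sep

end
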